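/-
Origin: expansion seat `literature-prover-pub-hodgecm-cf-hasseminkowski-g5-0`, handover #5 2026-08-18T06:29:25Z (`HOME/pub-hodgecm-cf-hasseminkowski-g5/handover/HodgeCM/Literature/ClassBaseChangeCompat.lean`, md5 c7f0de5f, 170 lines);
landed by the gen-7 packager in gate run 25 as `HodgeCM/Literature/ClassBaseChangeCompat.lean` (verbatim).
-/
/-
Origin: CITED-FACT seat (4), unit `pub-hodgecm-cf-hasseminkowski-g5` (session literature-prover-pub-hodgecm-cf-hasseminkowski-g5-0),
HodgeCM publication cell, 2026-08-18.  Intended landing: `HodgeCM/Literature/ClassBaseChangeCompat.lean` (after `ClassBaseChangeInjective.lean`).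
-/
import Summits.HodgeConjecture.HodgeCM.Literature.ClassBaseChangeInjective

/-!
# `hcompat` reduced to PerL's archimedean sentence "the two prescriptions agree on `L^×_{0,∞}`"

PerL v5 §3.2, tex ll. 307–308 (node N15): "the two prescriptions agree on `L^×_∞ ∩ 𝔸^×_{L₀} = L^×_{0,∞}` and are
trivial on `L^× ∩ 𝔸^×_{L₀}L^×_∞ = L₀^×`".  pv10's capstone hypothesis `hcompat` quantifies over ALL idele classes
`a` of `L₀` whose base change is the class of an infinite idele `u` of `L`; PerL checks compatibility only on
`L^×_{0,∞}`.  The reduction between the two is the displayed intersection `L^× ∩ 𝔸^×_{L₀}L^×_∞ = L₀^×` (pv10 typed its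
algebraic heart, `TensorIntersection.lean`, "the identification itself stays untyped: adelic base change absent from
Mathlib").  With the base change now constructed (`ClassBaseChange.lean`) the reduction is KERNEL:

* `ClassBaseChange.exists_infUnits_of_classBaseChange_eq` (`L/K` Galois): if `ι [x] = [(u, 1)]` in `C_L` then
  `[x] = [(y, 1)]` for an infinite idele `y` of `K` with `u = y_L` — proof: `x_L · (ℓ) = (u,1)` for some `ℓ ∈ L^×`;
  comparing finite parts of `σ • (ℓ) = (σ ℓ)` (the vendored `AdeleRing.smul_algebraMap`, `smul_ideleBaseChange`)
  gives `σ ℓ = ℓ` for all `σ ∈ Gal(L/K)`, so `ℓ = k ∈ K^×` (Mathlib `IsGalois.mem_bot_iff_fixed`); then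
  `z := x · (k)` has `z_L = (u, 1)`, hence trivial finite part (`FiniteAdeleRing.baseChange_injective`) and
  archimedean part `y` with `y_L = u`.
* **`hcompat_of_arch`**: pv10's `hcompat` for `f = classBaseChange K L` follows from the archimedean statement
  `∀ y : K_∞^×, χA [y] = infinityTypeChar L e (y_L)` — PerL's l. 307 literally; its place-by-place content for
  `χA = ε^m_{L/L₀}` and `e = (m_b)` is pv10's `RealPlaceSigns` (`(x/|x|)^{m_b} = sgn(x)^m` on `ℝ^×` iff `m_b ≡ m (2)`).
* **`exists_unitaryHeckeCharacter_of_isCMField_arch`**: N15 for a CM field with inputs `χA`, `hχA`, `e` and the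
  ARCHIMEDEAN compatibility only.

No PerL/QW8/2001 statement is used; no named fact is introduced; everything below is proved.
-/

set_option autoImplicit false

noncomputable section

open NumberField InfinitePlace IsDedekindDomain

namespace NumberField

open Literature.NumberTheory Literature.NumberTheory.Automorphic

variable (K L : Type) [Field K] [NumberField K] [Field L] [NumberField L] [Algebra K L]

namespace ClassBaseChange

omit [Algebra K L] in
/-- A number field has a finite place. -/
theorem nonempty_heightOneSpectrum : Nonempty (HeightOneSpectrum (𝓞 L)) := by
  obtain ⟨I, hI⟩ := Ideal.exists_maximal (𝓞 L)
  exact ⟨⟨I, hI.isPrime, Ring.ne_bot_of_isMaximal_of_not_isField hI (RingOfIntegers.not_isField L)⟩⟩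

omit [NumberField K] [Algebra K L] in
/-- The diagonal embedding `L → 𝔸_{L,f}` (finite part of `L → 𝔸_L`) is injective. -/
theorem algebraMap_snd_injective {ℓ ℓ' : L}
    (h : (algebraMap L (AdeleRing (𝓞 L) L) ℓ).2 = (algebraMap L (AdeleRing (𝓞 L) L) ℓ').2) : ℓ = ℓ' := by
  obtain ⟨w⟩ := nonempty_heightOneSpectrum L
  have hw := congrFun (congrArg (fun z : FiniteAdeleRing (𝓞 L) L => (z : ∀ v, _)) h) w
  simp only [AdeleRing.algebraMap_snd_apply] at hw
  exact (algebraMap L (w.adicCompletion L)).injective hw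

/-- The base change of infinite ideles `K_∞^× → L_∞^×`. -/
def infBaseChange : (InfiniteAdeleRing K)ˣ →* (InfiniteAdeleRing L)ˣ :=
  Units.map (InfiniteAdeleRing.baseChange K L).toMonoidHom

omit [NumberField K] [NumberField L] in
/-- (Ported verbatim from the HodgeCMPerL package; no docstring in the source.) -/
theorem coe_infBaseChange (y : (InfiniteAdeleRing K)ˣ) :
    ((infBaseChange K L y : (InfiniteAdeleRing L)ˣ) : InfiniteAdeleRing L) =
      InfiniteAdeleRing.baseChange K L (y : InfiniteAdeleRing K) := rfl

/-- `(y, 1)_L = (y_L, 1)`. -/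
theorem ideleBaseChange_infUnitsToIdele (y : (InfiniteAdeleRing K)ˣ) :
    AdeleRing.ideleBaseChange K L (infUnitsToIdele K y) = infUnitsToIdele L (infBaseChange K L y) := by
  refine Units.ext (Prod.ext ?_ ?_)
  · rw [AdeleRing.coe_ideleBaseChange, coe_infUnitsToIdele, coe_infUnitsToIdele, AdeleRing.baseChange_fst,
      coe_infBaseChange]
  · rw [AdeleRing.coe_ideleBaseChange, coe_infUnitsToIdele, coe_infUnitsToIdele, AdeleRing.baseChange_snd, map_one]

/-- **`L^× ∩ 𝔸^×_{L₀}L^×_∞ = L₀^×`, in use** (`L/K` Galois): if the base change of the class of `x ∈ 𝕀_K` is the class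
of an infinite idele `u` of `L`, then that class is already the class of an infinite idele `y` of `K` with `y_L = u`. -/
theorem exists_infUnits_of_classBaseChange_eq [IsGalois K L] (x : ideleGroup K) (u : (InfiniteAdeleRing L)ˣ)
    (h : classBaseChange K L (QuotientGroup.mk x) = infUnitsToClass L u) :
    ∃ y : (InfiniteAdeleRing K)ˣ, (QuotientGroup.mk x : IdeleClassGroup K) = infUnitsToClass K y ∧
      infBaseChange K L y = u := by
  classical
  set BC := AdeleRing.ideleBaseChange K L with hBC
  set U : ideleGroup L := infUnitsToIdele L u with hU
  -- `x_L⁻¹ · (u,1)` is principal: `= (ℓ)`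
  have h1 : (QuotientGroup.mk (BC x) : IdeleClassGroup L) = QuotientGroup.mk U := by
    rw [← classBaseChange_mk]; exact h
  obtain ⟨ℓ, hℓ⟩ := (QuotientGroup.eq.mp h1)
  -- hℓ : Units.map (algebraMap L 𝔸_L) ℓ = (BC x)⁻¹ * U
  -- finite parts: `(σ • (ℓ))_f = (ℓ)_f`, because `σ` fixes `x_L` and `U_f = 1`
  have hUf : ((U : ideleGroup L) : AdeleRing (𝓞 L) L).2 = 1 := by
    rw [hU, coe_infUnitsToIdele]
  have hmul : ∀ a b : AdeleRing (𝓞 L) L, (a * b).2 = a.2 * b.2 := fun _ _ => rfl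
  have hfix : ∀ σ : L ≃ₐ[K] L, σ (ℓ : L) = ℓ := by
    intro σ
    have h2 : ((σ • ((BC x)⁻¹ * U) : ideleGroup L) : AdeleRing (𝓞 L) L).2 =
        ((((BC x)⁻¹ * U : ideleGroup L)) : AdeleRing (𝓞 L) L).2 := by
      rw [smul_mul', smul_inv', hBC, AdeleRing.smul_ideleBaseChange, Units.val_mul, Units.val_mul, hmul, hmul,
        AdeleRing.coe_smul_units, AdeleRing.smul_snd, hUf, smul_one]
    rw [← hℓ, AdeleRing.coe_smul_units, Units.coe_map, MonoidHom.coe_coe, AdeleRing.smul_algebraMap] at h2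
    exact algebraMap_snd_injective L h2
  -- so `ℓ = k ∈ K^×`
  have hmem : (ℓ : L) ∈ (⊥ : IntermediateField K L) := (IsGalois.mem_bot_iff_fixed (ℓ : L)).mpr hfix
  obtain ⟨k, hk⟩ := IntermediateField.mem_bot.mp hmem
  have hk0 : k ≠ 0 := by
    rintro rfl
    exact ℓ.ne_zero (by rw [← hk, map_zero])
  set Pk : ideleGroup K := Units.map (algebraMap K (AdeleRing (𝓞 K) K) : K →* AdeleRing (𝓞 K) K)
    (Units.mk0 k hk0) with hPk
  have hPk_mem : Pk ∈ principalIdeles K := ⟨Units.mk0 k hk0, rfl⟩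
  have hBCPk : BC Pk = Units.map (algebraMap L (AdeleRing (𝓞 L) L) : L →* AdeleRing (𝓞 L) L) ℓ := by
    refine Units.ext ?_
    rw [hBC, AdeleRing.coe_ideleBaseChange, hPk, Units.coe_map, MonoidHom.coe_coe, Units.val_mk0,
      AdeleRing.baseChange_algebraMap, hk, Units.coe_map, MonoidHom.coe_coe]
  -- `z := x · (k)` has `z_L = (u, 1)`
  set z : ideleGroup K := x * Pk with hz
  have hzL : BC z = U := by
    rw [hz, map_mul, hBCPk, hℓ, mul_inv_cancel_left]
  -- hence `z_f = 1`, i.e. `z = (y, 1)` for the archimedean part `y` of `z`, and `y_L = u`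
  have hzf : ((z : ideleGroup K) : AdeleRing (𝓞 K) K).2 = 1 := by
    apply FiniteAdeleRing.baseChange_injective (𝓞 K) K L (𝓞 L)
    rw [map_one, ← AdeleRing.baseChange_snd, ← AdeleRing.coe_ideleBaseChange, ← hBC, hzL, hUf]
  have hz2 : ((ideleGroupSplitMulEquiv K) z).2 = 1 := Units.ext hzf
  set y : (InfiniteAdeleRing K)ˣ := ((ideleGroupSplitMulEquiv K) z).1 with hy
  have hyz : infUnitsToIdele K y = z := by
    show (ideleGroupSplitMulEquiv K).symm (((ideleGroupSplitMulEquiv K) z).1, 1) = z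
    rw [← hz2, Prod.mk.eta, MulEquiv.symm_apply_apply]
  refine ⟨y, ?_, ?_⟩
  · -- `[x] = [z] = [(y,1)]`
    show (QuotientGroup.mk x : IdeleClassGroup K) = QuotientGroup.mk (infUnitsToIdele K y)
    rw [hyz, hz]
    exact QuotientGroup.eq.mpr (by rw [inv_mul_cancel_left]; exact hPk_mem)
  · refine Units.ext ?_
    have h3 : InfiniteAdeleRing.baseChange K L ((z : ideleGroup K) : AdeleRing (𝓞 K) K).1 =
        (u : InfiniteAdeleRing L) :=
      congrArg (fun w : ideleGroup L => (w : AdeleRing (𝓞 L) L).1) hzL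
    rw [coe_infBaseChange, ← h3, ← hyz, coe_infUnitsToIdele]

end ClassBaseChange

open ClassBaseChange in
/-- **pv10's `hcompat` from PerL's archimedean sentence** (l. 307: "the two prescriptions agree on `L^×_{0,∞}`"),
for `f = classBaseChange K L`, `L/K` Galois. -/
theorem hcompat_of_arch [IsGalois K L] (χA : IdeleClassGroup K →* Circle) (e : InfinitePlace L → ℤ)
    (harch : ∀ y : (InfiniteAdeleRing K)ˣ,
      χA (infUnitsToClass K y) = infinityTypeChar L e (infBaseChange K L y))
    (a : IdeleClassGroup K) (u : (InfiniteAdeleRing L)ˣ) (h : classBaseChange K L a = infUnitsToClass L u) :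
    χA a = infinityTypeChar L e u := by
  induction a using QuotientGroup.induction_on with
  | H x =>
    obtain ⟨y, hy, hyu⟩ := exists_infUnits_of_classBaseChange_eq K L x u h
    rw [hy, harch, hyu]

/-- **N15 for a CM field, archimedean form of the compatibility**: inputs `χA : C_{L⁺} →* S¹` continuous, an infinity
type `e`, and PerL's l. 307 compatibility on `L^×_{0,∞}` only. -/
theorem exists_unitaryHeckeCharacter_of_isCMField_arch (L : Type) [Field L] [NumberField L] [IsCMField L]
    (χA : IdeleClassGroup (maximalRealSubfield L) →* Circle) (hχA : Continuous χA) (e : InfinitePlace L → ℤ)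
    (harch : ∀ y : (InfiniteAdeleRing (maximalRealSubfield L))ˣ,
      χA (infUnitsToClass (maximalRealSubfield L) y) =
        infinityTypeChar L e (ClassBaseChange.infBaseChange (maximalRealSubfield L) L y)) :
    ∃ ψ : UnitaryHeckeCharacter L, ψ.HasInfinityType L e ∧
      ∀ a, ψ (classBaseChange (maximalRealSubfield L) L a) = χA a :=
  exists_unitaryHeckeCharacter_of_isCMField' L χA hχA e
    (hcompat_of_arch (maximalRealSubfield L) L χA e harch)

end NumberField

end
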